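import Summits.BirchSwinnertonDyer.BirchSwinnertonDyer.Theorems.CMKolyvaginAtInertTwoCMKolyvaginConjectureAtInertTwoPositiveDepthGenusCharacterDescent
import Summits.BirchSwinnertonDyer.BirchSwinnertonDyer.Theorems.CMKolyvaginAtInertTwoCMKolyvaginConjectureAtInertTwoAllShallowGenusDescent
import Summits.BirchSwinnertonDyer.BirchSwinnertonDyer.Theorems.CMKolyvaginAtInertTwoCMKolyvaginConjectureAtInertTwoTwistCoordinatesAllLevels
import HarnessLib

/-!
# Crux `CMKolyvaginConjectureAtInertTwo` (stmt-BirchSwinnertonDyer-24648), open stub `stub_positiveDepth`: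
# DESCENT TO `K` AT EVERY SQUARE-FREE CM-INERT KOLYVAGIN LEVEL — the SIGNED genus trace `G_χ` is
# `Gal(K[n]/K)`-equivariant for the sign character `χ_Θ` (`Θ² = n*`), and `P(n) ∈ 2E(K[n]) ⟺ G_χ ∈ 2·(ι_Θ(E^{(n*)}(K)) ∪ {O})`

Route `CMKolyvaginAtInertTwo` (cell `pub/bsd-eis`, seat `leafhand-bsd-cmkolyvaginatinert-4` g0); helper (`--supports
stmt-BirchSwinnertonDyer-24648 --as helper`). THEOREMS ONLY (no definition, no named fact, no `sorry`); closes nothing; BSD is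
proved for no curve. All-levels sequel of `…PositiveDepthGenusCharacterDescent.lean` (p824044, prime level), on top of hand -1's genus
trace (`two_dvd_derivedPoint_iff_two_dvd_genusTrace`, p795141), hand -2's `±1`-action of `G_n` on the genus norm (p799182) and hand -3's
`Θ = ∏ θ_ℓ` (`exists_prod_sqrt_of_isKolyvaginPrime`, p822661).

WHAT. At a square-free level `n` all of whose prime factors are CM-inert Zhang–Kolyvagin primes at `2`, with a datum `d` (generators
`σ_ℓ`, transversal `S` of `G_n = Gal(K[n]/K[1])` in `𝒢_n = Gal(K[n]/K)`), genus norm `𝒩_n y(n) = ∏_{ℓ∣n} Σ_{k<(ℓ+1)/2} σ_ℓ^{2k} y(n)`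
and a function `χ : Aut_ℚ(K[n]) → {±1}`, multiplicative, with `χ(σ_ℓ) = −1` for every `ℓ ∣ n` (e.g. the sign character `χ_Θ`
of `Θ`, `Θ² = n*`, `σ_ℓΘ = −Θ`), put `G_χ := Σ_{s ∈ S} χ(s)·s(𝒩_n y(n))` (the SIGNED genus trace). Then:
* §1 (algebra) `map_eq_chi_smul_of_mem_foldr_span` (a product `∏ σ_ℓ^{i_ℓ}` acts on an all-`σ_ℓ`-anti vector by `χ`);
  `map_sum_transversal_chi_smul` (**the signed transversal sum of an `H`-`χ`-eigenvector is `𝒢`-`χ`-equivariant** — left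
  multiplication by `h ∈ 𝒢` permutes the cosets `sH`, and the `H`-correction acts by `χ`); `chi_equivariant_of_two_zsmul_eq`;
  `exists_sum_chi_smul_eq_sum_add_two_zsmul` (`G_χ ≡ G_d (mod 2)`).
* §2 `pointGalHom_genusNorm_eq_chi_smul` (`g ∈ G_n` acts on `𝒩_n y(n)` by `χ(g)`), **`pointGalHom_genusTraceChi_eq_chi_smul`**
  (`h·G_χ = χ(h)·G_χ` for all `h ∈ Gal(K[n]/K)`), `two_dvd_derivedPoint_iff_two_dvd_genusTraceChi` (`P(n) ∈ 2E(K[n]) ⟺ G_χ ∈ 2E(K[n])`).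
* §3 **`two_dvd_derivedPoint_iff_exists_rational_twistCoords_allLevels`**: on H₂ (CM, `2` inert in `F`, `ρ̄_{E,2}` onto; `K` with odd
  `d_K ≠ −3`, Heegner), with `Θ ∈ K[n]`, `Θ ≠ 0`, `Θ² = c ∈ ℚ`, `σ_ℓΘ = −Θ` for all `ℓ ∣ n`, `χ = χ_Θ`:
  `P_d(n) ∈ 2E(K[n]) ⟺ G_χ = 2R` with `R = O` or `R = ι_Θ(k₁, k₂)`, `(k₁, k₂)` a `K`-RATIONAL point of `E^{(c)} : c·k₂² = 4k₁³ + b₂k₁² + 2b₄k₁ + b₆`;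
  and `G_χ` itself is `O` or such a transport (`genusTraceChi_eq_zero_or_rational_twistCoords`); packaged with `Θ² = n* = ∏ ℓ*` in
  `exists_prod_sqrt_chi_two_dvd_derivedPoint_iff`.

So at EVERY level the clause of Kolyvagin's conjecture at CM-inert `2` lives in ONE quadratic twist `E^{(n*)}` over the FIXED field `K`
(hand -3 had it over `K[1]` for the unsigned trace `G_d`, which is not Galois-equivariant). HONEST FRAMING: compositions of tree theorems
with elementary group algebra; the non-vanishing is untouched; no stub or item is closed; BSD is proved for no curve.
References: [cite: GrossLMS1991, §3 (3.5), (G_n = ∏ G_ℓ), §4 (4.1)] [cite: Cox2013, Thm. 9.18, §9.A] [cite: SilvermanAEC2009, X.2 Prop. 2.4, X.5 Cor. 5.4].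
-/

set_option linter.dupNamespace false -- `Summit.BirchSwinnertonDyer.BirchSwinnertonDyer.Theorems.…` (summit = sub)
set_option autoImplicit false

noncomputable section

open scoped Classical

namespace Summit.BirchSwinnertonDyer.BirchSwinnertonDyer.Theorems.CMKolyvaginConjecturePositiveDepth

open Finset WeierstrassCurve NumberField Literature.NumberTheory.EllipticCurves
  Literature.NumberTheory.EllipticCurves.ModularForms
  Literature.NumberTheory.EllipticCurves.Rank1Residual

/-! ## §1 Group algebra -/

section Algebra

variable {G : Type*} [Group G] {A : Type*} [AddCommGroup A] (ρ : G →* AddMonoid.End A)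

/-- `χ(1) = 1` for a multiplicative `±1`-valued `χ`. [folklore] -/
theorem chi_one_eq_one (χ : G → ℤ) (hmul : ∀ g h, χ (g * h) = χ g * χ h) (hone : ∀ g, χ g = 1 ∨ χ g = -1) :
    χ 1 = 1 := by
  have h := hmul 1 1
  rw [mul_one] at h
  rcases hone 1 with h1 | h1
  · exact h1
  · rw [h1] at h; norm_num at h

omit [Group G] in
/-- `χ(g)·χ(g) = 1` for a `±1`-valued `χ`. [folklore] -/
theorem chi_mul_self_eq_one (χ : G → ℤ) (hone : ∀ g, χ g = 1 ∨ χ g = -1) (g : G) : χ g * χ g = 1 := by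
  rcases hone g with h | h <;> rw [h] <;> norm_num

/-- `χ(g⁻¹) = χ(g)` for a multiplicative `±1`-valued `χ`. [folklore] -/
theorem chi_inv_eq (χ : G → ℤ) (hmul : ∀ g h, χ (g * h) = χ g * χ h) (hone : ∀ g, χ g = 1 ∨ χ g = -1) (g : G) :
    χ g⁻¹ = χ g := by
  have h := hmul g g⁻¹
  rw [mul_inv_cancel, chi_one_eq_one χ hmul hone] at h
  rcases hone g with h1 | h1 <;> rw [h1] at h ⊢ <;> linarith [hone g⁻¹]

/-- `χ(g^i) = χ(g)^i` for a multiplicative `±1`-valued `χ`. [folklore] -/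
theorem chi_pow_eq (χ : G → ℤ) (hmul : ∀ g h, χ (g * h) = χ g * χ h) (hone : ∀ g, χ g = 1 ∨ χ g = -1) (g : G)
    (i : ℕ) : χ (g ^ i) = χ g ^ i := by
  induction i with
  | zero => rw [pow_zero, pow_zero, chi_one_eq_one χ hmul hone]
  | succ i ih => rw [pow_succ, hmul, ih, pow_succ]

/-- **A product `∏_{ℓ∈L} σ_ℓ^{i_ℓ}` acts on an all-anti vector by `χ`.** If each `σ_ℓ` (`ℓ ∈ L`) acts on `a` by `−1` and
`χ` is multiplicative, `±1`-valued with `χ(σ_ℓ) = −1` for `ℓ ∈ L`, then every `g` in the multi-index span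
`L.foldr (fun ℓ T ↦ (range (ℓ+1) ×ˢ T).image (σ_ℓ^i · t)) {1}` acts on `a` by `χ(g)` (refines hand -2's
`eq_or_eq_neg_of_mem_foldr_span`). [cite: GrossLMS1991, §3 (G_n = ∏ G_ℓ)] -/
theorem map_eq_chi_smul_of_mem_foldr_span (σ : ℕ → G) (a : A) (L : List ℕ) (hneg : ∀ ℓ ∈ L, ρ (σ ℓ) a = -a)
    (χ : G → ℤ) (hmul : ∀ g h, χ (g * h) = χ g * χ h) (hone : ∀ g, χ g = 1 ∨ χ g = -1)
    (hσ : ∀ ℓ ∈ L, χ (σ ℓ) = -1) :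
    ∀ g ∈ L.foldr (fun ℓ T ↦ (range (ℓ + 1) ×ˢ T).image (fun p ↦ σ ℓ ^ p.1 * p.2)) ({1} : Finset G),
      ρ g a = χ g • a := by
  induction L with
  | nil =>
    intro g hg
    simp only [List.foldr_nil, Finset.mem_singleton] at hg
    rw [hg, map_one, chi_one_eq_one χ hmul hone, one_smul]
    rfl
  | cons ℓ L ih =>
    intro g hg
    simp only [List.foldr_cons, Finset.mem_image, Finset.mem_product, Finset.mem_range, Prod.exists] at hg
    obtain ⟨i, g', ⟨-, hg'⟩, rfl⟩ := hg
    have hL : ∀ ℓ' ∈ L, ρ (σ ℓ') a = -a := fun ℓ' h ↦ hneg ℓ' (List.mem_cons_of_mem ℓ h)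
    have hLσ : ∀ ℓ' ∈ L, χ (σ ℓ') = -1 := fun ℓ' h ↦ hσ ℓ' (List.mem_cons_of_mem ℓ h)
    have hi : ρ (σ ℓ ^ i) a = ((-1 : ℤ) ^ i) • a :=
      pow_smul_eq_neg_one_pow_of_eq_neg ρ (σ ℓ) a (hneg ℓ List.mem_cons_self) i
    rw [map_mul]
    change ρ (σ ℓ ^ i) (ρ g' a) = _
    rw [ih hL hLσ g' hg', map_zsmul, hi, smul_smul, hmul, chi_pow_eq χ hmul hone, hσ ℓ List.mem_cons_self, mul_comm]

/-- **The signed transversal sum of an `H`-`χ`-eigenvector is `𝒢`-`χ`-equivariant.** Let `H ≤ 𝒢` be subgroups of `G`,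
`S ⊆ 𝒢` a system of representatives of `𝒢/H` (`∀ g ∈ 𝒢, ∃! s ∈ S, g⁻¹ s ∈ H`), `χ` multiplicative and `±1`-valued, and
`F ∈ A` with `hF = χ(h)F` for `h ∈ H`. Then for every `h ∈ 𝒢`: `h·(Σ_{s∈S} χ(s)·sF) = χ(h)·Σ_{s∈S} χ(s)·sF` (left
multiplication by `h` permutes the cosets: `hs = s'k⁻¹`, `k ∈ H`, and `χ(s)χ(k) = χ(h)χ(s')`).
[cite: GrossLMS1991, §4 (4.1) and the remark that [P_n] is independent of S] -/
theorem map_sum_transversal_chi_smul (𝒢 H : Subgroup G) (F : A) (χ : G → ℤ)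
    (hmul : ∀ g h, χ (g * h) = χ g * χ h) (hone : ∀ g, χ g = 1 ∨ χ g = -1)
    (hF : ∀ h ∈ H, ρ h F = χ h • F)
    (S : Finset G) (hS : ∀ s ∈ S, s ∈ 𝒢) (hT : ∀ g ∈ 𝒢, ∃! s, s ∈ S ∧ g⁻¹ * s ∈ H)
    {h : G} (hh : h ∈ 𝒢) :
    ρ h (∑ s ∈ S, χ s • ρ s F) = χ h • ∑ s ∈ S, χ s • ρ s F := by
  -- the matchings `φ` (for `h`) and `ψ` (for `h⁻¹`) of `S`
  have hex : ∀ s ∈ S, ∃ s', s' ∈ S ∧ (h * s)⁻¹ * s' ∈ H := fun s hs ↦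
    (hT (h * s) (𝒢.mul_mem hh (hS s hs))).exists
  have hex' : ∀ s ∈ S, ∃ s', s' ∈ S ∧ (h⁻¹ * s)⁻¹ * s' ∈ H := fun s hs ↦
    (hT (h⁻¹ * s) (𝒢.mul_mem (𝒢.inv_mem hh) (hS s hs))).exists
  choose! φ hφS hφH using hex
  choose! ψ hψS hψH using hex'
  have hψφ : ∀ s ∈ S, ψ (φ s) = s := fun s hs ↦ by
    have h1 : (h⁻¹ * φ s)⁻¹ * s ∈ H := by
      have := H.inv_mem (hφH s hs)
      rw [show ((h * s)⁻¹ * φ s)⁻¹ = (h⁻¹ * φ s)⁻¹ * s by group] at this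
      exact this
    exact (hT (h⁻¹ * φ s) (𝒢.mul_mem (𝒢.inv_mem hh) (hS _ (hφS s hs)))).unique
      ⟨hψS _ (hφS s hs), hψH _ (hφS s hs)⟩ ⟨hs, h1⟩
  have hφψ : ∀ s ∈ S, φ (ψ s) = s := fun s hs ↦ by
    have h1 : (h * ψ s)⁻¹ * s ∈ H := by
      have := H.inv_mem (hψH s hs)
      rw [show ((h⁻¹ * s)⁻¹ * ψ s)⁻¹ = (h * ψ s)⁻¹ * s by group] at this
      exact this
    exact (hT (h * ψ s) (𝒢.mul_mem hh (hS _ (hψS s hs)))).unique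
      ⟨hφS _ (hψS s hs), hφH _ (hψS s hs)⟩ ⟨hs, h1⟩
  rw [map_sum, Finset.smul_sum]
  refine Finset.sum_nbij' φ ψ hφS hψS hψφ hφψ (fun s hs ↦ ?_)
  -- `h s = φ s · k⁻¹` with `k = (hs)⁻¹ φ s ∈ H`
  have hχφ : χ (φ s) = χ h * χ s * χ ((h * s)⁻¹ * φ s) := by
    conv_lhs => rw [show φ s = h * s * ((h * s)⁻¹ * φ s) by group]
    rw [hmul, hmul]
  set k := (h * s)⁻¹ * φ s with hk_def
  have hk : k ∈ H := hφH s hs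
  have hhs : h * s = φ s * k⁻¹ := by rw [hk_def]; group
  calc ρ h (χ s • ρ s F) = χ s • ρ (h * s) F := by rw [map_zsmul, map_mul]; rfl
    _ = χ s • ρ (φ s) (ρ k⁻¹ F) := by rw [hhs, map_mul]; rfl
    _ = (χ s * χ k) • ρ (φ s) F := by
        rw [hF _ (H.inv_mem hk), map_zsmul, smul_smul, chi_inv_eq χ hmul hone]
    _ = χ h • χ (φ s) • ρ (φ s) F := by
        rw [smul_smul, hχφ]
        congr 1
        have h1 := chi_mul_self_eq_one χ hone h
        linear_combination (-(χ s * χ k)) * h1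

/-- **Equivariance descends through `2`.** If `A` has no `2`-torsion, `ρ h Y = χ(h)·Y` and `2R = Y`, then `ρ h R = χ(h)·R`. [folklore] -/
theorem chi_equivariant_of_two_zsmul_eq (h2 : ∀ T : A, (2 : ℤ) • T = 0 → T = 0) (χ : G → ℤ) {h : G}
    {Y R : A} (hY : ρ h Y = χ h • Y) (hR : (2 : ℤ) • R = Y) : ρ h R = χ h • R := by
  have h4 : (2 : ℤ) • (ρ h R - χ h • R) = 0 := by
    rw [smul_sub, ← map_zsmul, hR, hY, smul_comm, hR, sub_self]
  exact sub_eq_zero.mp (h2 _ h4)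

/-- **Signed and unsigned sums agree modulo `2`**: for a `±1`-valued `χ`, `Σ_s χ(s)·x_s = Σ_s x_s + 2T` for some `T`. [folklore] -/
theorem exists_sum_chi_smul_eq_sum_add_two_zsmul {ι' : Type*} (S : Finset ι') (χ : ι' → ℤ)
    (hone : ∀ s ∈ S, χ s = 1 ∨ χ s = -1) (x : ι' → A) :
    ∃ T : A, ∑ s ∈ S, χ s • x s = ∑ s ∈ S, x s + (2 : ℤ) • T := by
  refine ⟨∑ s ∈ S, ((χ s - 1) / 2) • x s, ?_⟩
  rw [Finset.smul_sum, ← Finset.sum_add_distrib]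
  refine Finset.sum_congr rfl fun s hs ↦ ?_
  rw [smul_smul]
  have hdiv : 2 * ((χ s - 1) / 2) = χ s - 1 := by
    rcases hone s hs with h | h <;> rw [h] <;> norm_num
  rw [hdiv, sub_smul, one_smul, add_sub_cancel]

end Algebra

variable {K : Type} [Field K] [NumberField K]

/-! ## §2 The signed genus trace at a square-free CM-inert Kolyvagin level is `Gal(K[n]/K)`-equivariant -/

/-- **`g ∈ G_n` acts on the genus norm by `χ(g)`.** Frame: `W/ℚ` globally minimal with CM, `K` imaginary quadratic with odd
`d_K ≠ −3`, Heegner for `N_E`; `n` square-free with CM-inert Zhang–Kolyvagin prime factors; `d` a datum; `χ : Aut_ℚ(K[n]) → {±1}`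
multiplicative with `χ(σ_ℓ) = −1` for every `ℓ ∣ n`. Then `g(𝒩_n y(n)) = χ(g)·𝒩_n y(n)` for every `g ∈ G_n = Gal(K[n]/K[1])`
(`G_n = ∏ G_ℓ`, tree `GenusKoly.mem_foldr_span_of_mem_ringClassGalOver_one`; each `σ_ℓ` acts by `−1`, hand -2's
`map_σ_foldr_normPart_eq_neg`). [cite: GrossLMS1991, §3 (G_n = ∏ G_ℓ), Prop. 3.7 (1)] -/
theorem pointGalHom_genusNorm_eq_chi_smul (W : WeierstrassCurve ℚ) [W.IsElliptic] [W.IsGloballyMinimal]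
    [NeZero (W.conductorNorm ℤ)] (hCM : W.HasCM) (hK : IsImaginaryQuadratic K)
    (hodd : Odd (NumberField.discr K)) (h3 : NumberField.discr K ≠ -3)
    (hH : SatisfiesHeegnerHypothesis (W.conductorNorm ℤ) K)
    {Dt : ModularParametrizationData W (W.conductorNorm ℤ)} {β : ℤ} {ι : K →+* ℂ} {n : ℕ} (hn : Squarefree n)
    (hKol : ∀ ℓ ∈ n.primeFactors, Zhang2014.IsKolyvaginPrime (W.conductorNorm ℤ) W K 2 ℓ ∧ CMInert W ℓ)
    (d : KolyvaginHeegnerData Dt β ι n)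
    (χ : (ringClassField K ι n ≃ₐ[ℚ] ringClassField K ι n) → ℤ) (hmul : ∀ g h, χ (g * h) = χ g * χ h)
    (hone : ∀ g, χ g = 1 ∨ χ g = -1) (hσ : ∀ ℓ ∈ n.primeFactors, χ (d.σ ℓ) = -1)
    {g : ringClassField K ι n ≃ₐ[ℚ] ringClassField K ι n} (hg : g ∈ ringClassGalOver ι n 1) :
    pointGalHom W (ringClassField K ι n) g (n.primeFactorsList.foldr
        (fun ℓ x ↦ ∑ k ∈ range ((ℓ + 1) / 2), pointGalHom W (ringClassField K ι n) ((d.σ ℓ ^ 2) ^ k) x) d.y) =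
      χ g • n.primeFactorsList.foldr
        (fun ℓ x ↦ ∑ k ∈ range ((ℓ + 1) / 2), pointGalHom W (ringClassField K ι n) ((d.σ ℓ ^ 2) ^ k) x) d.y := by
  have hD := GenusKoly.discr_lt_neg_four_of_odd hK hodd h3
  have hmem : ∀ q ∈ n.primeFactorsList, q ∈ n.primeFactors := fun q hq ↦
    Nat.mem_primeFactors_iff_mem_primeFactorsList.mpr hq
  have hspan := GenusKoly.mem_foldr_span_of_mem_ringClassGalOver_one hK ι hD hn
    (fun ℓ hℓ ↦ (hKol ℓ hℓ).1.2.2.2.2.1) d.zpowers_σ hg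
  refine map_eq_chi_smul_of_mem_foldr_span (pointGalHom W (ringClassField K ι n)) d.σ _ n.primeFactorsList
    (fun ℓ hℓ ↦ ?_) χ hmul hone (fun ℓ hℓ ↦ hσ ℓ (hmem ℓ hℓ)) g hspan
  have hℓ' := hmem ℓ hℓ
  exact map_σ_foldr_normPart_eq_neg (pointGalHom W (ringClassField K ι n)) d.σ ℓ
    ((hKol ℓ hℓ').1.1.odd_of_ne_two (hKol ℓ hℓ').1.2.2.2.1) n.primeFactorsList hℓ
    (fun q hq ↦ commute_σ_of_mem_primeFactors W hK hn.ne_zero d hℓ' (hmem q hq)) d.y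
    (sum_range_pointGalHom_σ_pow_y_eq_zero_of_mem_primeFactors W hCM hK hodd h3 hH hn hKol d hℓ')

/-- **The signed genus trace `G_χ = Σ_{s∈S} χ(s)·s(𝒩_n y(n))` is `χ`-equivariant under all of `Gal(K[n]/K)`** (same frame and
`χ`): `h·G_χ = χ(h)·G_χ` for every `h ∈ 𝒢_n`. (§1 `map_sum_transversal_chi_smul` with `H = G_n`, the datum's transversal `S`,
and `pointGalHom_genusNorm_eq_chi_smul`.) [cite: GrossLMS1991, §4 (4.1)] -/
theorem pointGalHom_genusTraceChi_eq_chi_smul (W : WeierstrassCurve ℚ) [W.IsElliptic] [W.IsGloballyMinimal]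
    [NeZero (W.conductorNorm ℤ)] (hCM : W.HasCM) (hK : IsImaginaryQuadratic K)
    (hodd : Odd (NumberField.discr K)) (h3 : NumberField.discr K ≠ -3)
    (hH : SatisfiesHeegnerHypothesis (W.conductorNorm ℤ) K)
    {Dt : ModularParametrizationData W (W.conductorNorm ℤ)} {β : ℤ} {ι : K →+* ℂ} {n : ℕ} (hn : Squarefree n)
    (hKol : ∀ ℓ ∈ n.primeFactors, Zhang2014.IsKolyvaginPrime (W.conductorNorm ℤ) W K 2 ℓ ∧ CMInert W ℓ)
    (d : KolyvaginHeegnerData Dt β ι n)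
    (χ : (ringClassField K ι n ≃ₐ[ℚ] ringClassField K ι n) → ℤ) (hmul : ∀ g h, χ (g * h) = χ g * χ h)
    (hone : ∀ g, χ g = 1 ∨ χ g = -1) (hσ : ∀ ℓ ∈ n.primeFactors, χ (d.σ ℓ) = -1)
    {h : ringClassField K ι n ≃ₐ[ℚ] ringClassField K ι n} (hh : h ∈ ringClassGal ι n) :
    pointGalHom W (ringClassField K ι n) h
        (∑ s ∈ d.S, χ s • pointGalHom W (ringClassField K ι n) s (n.primeFactorsList.foldr
          (fun ℓ x ↦ ∑ k ∈ range ((ℓ + 1) / 2), pointGalHom W (ringClassField K ι n) ((d.σ ℓ ^ 2) ^ k) x) d.y)) =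
      χ h • ∑ s ∈ d.S, χ s • pointGalHom W (ringClassField K ι n) s (n.primeFactorsList.foldr
          (fun ℓ x ↦ ∑ k ∈ range ((ℓ + 1) / 2), pointGalHom W (ringClassField K ι n) ((d.σ ℓ ^ 2) ^ k) x) d.y) :=
  map_sum_transversal_chi_smul (pointGalHom W (ringClassField K ι n)) (ringClassGal ι n) (ringClassGalOver ι n 1) _ χ
    hmul hone (fun _ hg ↦ pointGalHom_genusNorm_eq_chi_smul W hCM hK hodd h3 hH hn hKol d χ hmul hone hσ hg)
    d.S d.S_subset d.S_transversal hh

/-- **`P(n) ∈ 2E(K[n]) ⟺ G_χ ∈ 2E(K[n])`** (same frame and `χ`): hand -1's `two_dvd_derivedPoint_iff_two_dvd_genusTrace` and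
`G_χ ≡ G_d (mod 2)`. [cite: GrossLMS1991, §3 (3.5), §4 (4.1)] -/
theorem two_dvd_derivedPoint_iff_two_dvd_genusTraceChi (W : WeierstrassCurve ℚ) [W.IsElliptic] [W.IsGloballyMinimal]
    [NeZero (W.conductorNorm ℤ)] (hCM : W.HasCM) (hK : IsImaginaryQuadratic K)
    (hodd : Odd (NumberField.discr K)) (h3 : NumberField.discr K ≠ -3)
    (hH : SatisfiesHeegnerHypothesis (W.conductorNorm ℤ) K)
    {Dt : ModularParametrizationData W (W.conductorNorm ℤ)} {β : ℤ} {ι : K →+* ℂ} {n : ℕ} (hn : Squarefree n)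
    (hKol : ∀ ℓ ∈ n.primeFactors, Zhang2014.IsKolyvaginPrime (W.conductorNorm ℤ) W K 2 ℓ ∧ CMInert W ℓ)
    (d : KolyvaginHeegnerData Dt β ι n)
    (χ : (ringClassField K ι n ≃ₐ[ℚ] ringClassField K ι n) → ℤ) (hone : ∀ g, χ g = 1 ∨ χ g = -1) :
    (∃ Q : (W.baseChange (ringClassField K ι n)).toAffine.Point, (2 : ℤ) • Q = d.derivedPoint) ↔
      ∃ R : (W.baseChange (ringClassField K ι n)).toAffine.Point, (2 : ℤ) • R =
        ∑ s ∈ d.S, χ s • pointGalHom W (ringClassField K ι n) s (n.primeFactorsList.foldr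
          (fun ℓ x ↦ ∑ k ∈ range ((ℓ + 1) / 2), pointGalHom W (ringClassField K ι n) ((d.σ ℓ ^ 2) ^ k) x) d.y) := by
  rw [two_dvd_derivedPoint_iff_two_dvd_genusTrace W hCM hK hodd h3 hH hn hKol d]
  obtain ⟨T, hT⟩ := exists_sum_chi_smul_eq_sum_add_two_zsmul d.S χ (fun s _ ↦ hone s)
    (fun s ↦ pointGalHom W (ringClassField K ι n) s (n.primeFactorsList.foldr
      (fun ℓ x ↦ ∑ k ∈ range ((ℓ + 1) / 2), pointGalHom W (ringClassField K ι n) ((d.σ ℓ ^ 2) ^ k) x) d.y))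
  rw [hT]
  constructor
  · rintro ⟨Q, hQ⟩
    exact ⟨Q + T, by rw [smul_add, hQ]⟩
  · rintro ⟨R, hR⟩
    exact ⟨R - T, by rw [smul_sub, hR, add_sub_cancel_right]⟩

/-! ## §3 Descent to `K`: `G_χ` and its half are transports of `K`-rational points of `E^{(n*)}` -/

/-- **`G_{χ_Θ}` is the transport of a `K`-rational point of `E^{(c)}`** (frame of §2 with `χ = χ_Θ`, `Θ ∈ K[n]`, `Θ ≠ 0`,
`Θ² = c ∈ ℚ`, `σ_ℓΘ = −Θ` for all `ℓ ∣ n`): `G_χ = O` or `G_χ = (x, y)` with `x = ι k₁`, `(2y + a₁x + a₃)/Θ = ι k₂` and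
`c·k₂² = 4k₁³ + b₂k₁² + 2b₄k₁ + b₆` in `K`. [cite: SilvermanAEC2009, X.2 Prop. 2.4 (proof), X.5 Cor. 5.4] [cite: Cox2013, §9.A] -/
theorem genusTraceChi_eq_zero_or_rational_twistCoords (W : WeierstrassCurve ℚ) [W.IsElliptic] [W.IsGloballyMinimal]
    [NeZero (W.conductorNorm ℤ)] (hCM : W.HasCM) (hK : IsImaginaryQuadratic K)
    (hodd : Odd (NumberField.discr K)) (h3 : NumberField.discr K ≠ -3)
    (hH : SatisfiesHeegnerHypothesis (W.conductorNorm ℤ) K)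
    {Dt : ModularParametrizationData W (W.conductorNorm ℤ)} {β : ℤ} {ι : K →+* ℂ} {n : ℕ} (hn : Squarefree n)
    (hKol : ∀ ℓ ∈ n.primeFactors, Zhang2014.IsKolyvaginPrime (W.conductorNorm ℤ) W K 2 ℓ ∧ CMInert W ℓ)
    (d : KolyvaginHeegnerData Dt β ι n) {Θ : ringClassField K ι n} (hΘ : Θ ≠ 0) {c : ℚ}
    (hΘ2 : Θ ^ 2 = algebraMap ℚ (ringClassField K ι n) c) (hσΘ : ∀ ℓ ∈ n.primeFactors, d.σ ℓ Θ = -Θ)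
    (χ : (ringClassField K ι n ≃ₐ[ℚ] ringClassField K ι n) → ℤ) (hχp : ∀ g, g Θ = Θ → χ g = 1)
    (hχn : ∀ g, g Θ ≠ Θ → χ g = -1) :
    ∀ (x y : ringClassField K ι n) (h : (W.baseChange (ringClassField K ι n)).toAffine.Nonsingular x y),
      (∑ s ∈ d.S, χ s • pointGalHom W (ringClassField K ι n) s (n.primeFactorsList.foldr
          (fun ℓ x ↦ ∑ k ∈ range ((ℓ + 1) / 2), pointGalHom W (ringClassField K ι n) ((d.σ ℓ ^ 2) ^ k) x) d.y))
          = .some x y h →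
        ∃ k₁ k₂ : K, ι k₁ = x ∧
          ι k₂ = (((2 * y + (W.baseChange (ringClassField K ι n)).toAffine.a₁ * x +
            (W.baseChange (ringClassField K ι n)).toAffine.a₃) / Θ : ringClassField K ι n) : ℂ) ∧
          (c : K) * k₂ ^ 2 = 4 * k₁ ^ 3 + (W.b₂ : K) * k₁ ^ 2 + 2 * (W.b₄ : K) * k₁ + (W.b₆ : K) := by
  intro x y h hsum
  have hΘΘ : -Θ ≠ Θ := fun e ↦ hΘ (by
    have : (2 : ringClassField K ι n) * Θ = 0 := by linear_combination -e
    simpa using this)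
  have hσ : ∀ ℓ ∈ n.primeFactors, χ (d.σ ℓ) = -1 := fun ℓ hℓ ↦ hχn _ (by rw [hσΘ ℓ hℓ]; exact hΘΘ)
  have heq : ∀ g ∈ ringClassGal ι n, pointGalHom W (ringClassField K ι n) g (.some x y h) = χ g • (.some x y h) := by
    intro g hg
    rw [← hsum]
    exact pointGalHom_genusTraceChi_eq_chi_smul W hCM hK hodd h3 hH hn hKol d χ (chiTheta_mul hΘ hΘ2 χ hχp hχn)
      (chiTheta_eq_one_or Θ χ hχp hχn) hσ hg
  have hfix := coords_fixed_of_chiTheta_equivariant W hΘ hΘ2 χ hχp hχn (ringClassGal ι n) h heq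
  exact exists_rational_twistPoint_of_coords_mem_range W hΘ hΘ2 h.left
    (coe_mem_range_of_forall_mem_ringClassGal hK ι hn.ne_zero x fun g hg ↦ (hfix g hg).1)
    (coe_mem_range_of_forall_mem_ringClassGal hK ι hn.ne_zero _ fun g hg ↦ (hfix g hg).2)

/-- **Kolyvagin's clause at EVERY square-free CM-inert level, descended to `K`.** On H₂ (`W/ℚ` globally minimal with CM, `2` inert
in `F`, `ρ̄_{E,2}` onto), `K` imaginary quadratic with odd `d_K ≠ −3` and Heegner for `N_E`, `n` square-free with CM-inert
Zhang–Kolyvagin prime factors, `d` any datum, `Θ ∈ K[n]` with `Θ ≠ 0`, `Θ² = c ∈ ℚ`, `σ_ℓΘ = −Θ` for all `ℓ ∣ n` (exists with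
`c = n*`, p822661), `χ = χ_Θ`: **`P_d(n) ∈ 2E(K[n])` iff the signed genus trace `G_χ` is `2R` for a point `R ∈ E(K[n])` which is `O`
or `ι_Θ(k₁, k₂)` with `(k₁, k₂)` a `K`-rational point of `E^{(c)} : c·k₂² = 4k₁³ + b₂k₁² + 2b₄k₁ + b₆`.**
[cite: GrossLMS1991, §3 (3.5), §4 (4.1)] [cite: SilvermanAEC2009, X.5 Cor. 5.4] [cite: Cox2013, Thm. 9.18, §9.A] -/
theorem two_dvd_derivedPoint_iff_exists_rational_twistCoords_allLevels (W : WeierstrassCurve ℚ) [W.IsElliptic]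
    [W.IsGloballyMinimal] [NeZero (W.conductorNorm ℤ)] (hCM : W.HasCM) (hin : CMInert W 2)
    (hρ : W.HasSurjectiveModNGaloisRep (2 : ℤ)) (hK : IsImaginaryQuadratic K)
    (hodd : Odd (NumberField.discr K)) (h3 : NumberField.discr K ≠ -3)
    (hH : SatisfiesHeegnerHypothesis (W.conductorNorm ℤ) K)
    {Dt : ModularParametrizationData W (W.conductorNorm ℤ)} {β : ℤ} {ι : K →+* ℂ} {n : ℕ} (hn : Squarefree n)
    (hKol : ∀ ℓ ∈ n.primeFactors, Zhang2014.IsKolyvaginPrime (W.conductorNorm ℤ) W K 2 ℓ ∧ CMInert W ℓ)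
    (d : KolyvaginHeegnerData Dt β ι n) {Θ : ringClassField K ι n} (hΘ : Θ ≠ 0) {c : ℚ}
    (hΘ2 : Θ ^ 2 = algebraMap ℚ (ringClassField K ι n) c) (hσΘ : ∀ ℓ ∈ n.primeFactors, d.σ ℓ Θ = -Θ)
    (χ : (ringClassField K ι n ≃ₐ[ℚ] ringClassField K ι n) → ℤ) (hχp : ∀ g, g Θ = Θ → χ g = 1)
    (hχn : ∀ g, g Θ ≠ Θ → χ g = -1) :
    (∃ Q : (W.baseChange (ringClassField K ι n)).toAffine.Point, (2 : ℤ) • Q = d.derivedPoint) ↔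
      ∃ R : (W.baseChange (ringClassField K ι n)).toAffine.Point,
        (2 : ℤ) • R =
          ∑ s ∈ d.S, χ s • pointGalHom W (ringClassField K ι n) s (n.primeFactorsList.foldr
            (fun ℓ x ↦ ∑ k ∈ range ((ℓ + 1) / 2), pointGalHom W (ringClassField K ι n) ((d.σ ℓ ^ 2) ^ k) x) d.y) ∧
        ∀ (x y : ringClassField K ι n) (h : (W.baseChange (ringClassField K ι n)).toAffine.Nonsingular x y),
          R = .some x y h →
            ∃ k₁ k₂ : K, ι k₁ = x ∧
              ι k₂ = (((2 * y + (W.baseChange (ringClassField K ι n)).toAffine.a₁ * x +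
                (W.baseChange (ringClassField K ι n)).toAffine.a₃) / Θ : ringClassField K ι n) : ℂ) ∧
              (c : K) * k₂ ^ 2 = 4 * k₁ ^ 3 + (W.b₂ : K) * k₁ ^ 2 + 2 * (W.b₄ : K) * k₁ + (W.b₆ : K) := by
  have hΘΘ : -Θ ≠ Θ := fun e ↦ hΘ (by
    have : (2 : ringClassField K ι n) * Θ = 0 := by linear_combination -e
    simpa using this)
  have hσ : ∀ ℓ ∈ n.primeFactors, χ (d.σ ℓ) = -1 := fun ℓ hℓ ↦ hχn _ (by rw [hσΘ ℓ hℓ]; exact hΘΘ)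
  have hone := chiTheta_eq_one_or Θ χ hχp hχn
  have hmul := chiTheta_mul hΘ hΘ2 χ hχp hχn
  rw [two_dvd_derivedPoint_iff_two_dvd_genusTraceChi W hCM hK hodd h3 hH hn hKol d χ hone]
  refine ⟨fun ⟨R, hR⟩ ↦ ⟨R, hR, fun x y h hRe ↦ ?_⟩, fun ⟨R, hR, _⟩ ↦ ⟨R, hR⟩⟩
  subst hRe
  have heq : ∀ g ∈ ringClassGal ι n, pointGalHom W (ringClassField K ι n) g (.some x y h) = χ g • (.some x y h) :=
    fun g hg ↦ chi_equivariant_of_two_zsmul_eq (pointGalHom W (ringClassField K ι n))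
      (twoTorsion_eq_zero_of_cmInert_squarefree W hCM hin hρ hK ι hH hn (fun ℓ hℓ ↦ (hKol ℓ hℓ).2)) χ
      (pointGalHom_genusTraceChi_eq_chi_smul W hCM hK hodd h3 hH hn hKol d χ hmul hone hσ hg) hR
  have hfix := coords_fixed_of_chiTheta_equivariant W hΘ hΘ2 χ hχp hχn (ringClassGal ι n) h heq
  exact exists_rational_twistPoint_of_coords_mem_range W hΘ hΘ2 h.left
    (coe_mem_range_of_forall_mem_ringClassGal hK ι hn.ne_zero x fun g hg ↦ (hfix g hg).1)
    (coe_mem_range_of_forall_mem_ringClassGal hK ι hn.ne_zero _ fun g hg ↦ (hfix g hg).2)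

/-- **Packaged, with `Θ² = n* = ∏_{ℓ∣n} ℓ*`.** Same H₂ frame, `n` square-free with CM-inert Zhang–Kolyvagin prime factors, any datum
`d`: there are `Θ ∈ K[n]` (`Θ² = n*`, `Θ ≠ 0`, `σ_ℓΘ = −Θ` for all `ℓ ∣ n`; hand -3's `exists_prod_sqrt_of_isKolyvaginPrime`) and its sign
character `χ = χ_Θ` (multiplicative, `±1`-valued) such that **`P_d(n) ∈ 2E(K[n])` iff `G_χ = Σ_{s∈S} χ(s)·s(𝒩_n y(n))` is `2R` with
`R = O` or `R = ι_Θ(k₁, k₂)`, `(k₁, k₂) ∈ E^{(n*)}(K)`** (`n*·k₂² = 4k₁³ + b₂k₁² + 2b₄k₁ + b₆` in `K`).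
[cite: GrossLMS1991, §3 (3.5), §4 (4.1)] [cite: Cox2013, Thm. 9.18, §9.A] [cite: SilvermanAEC2009, X.5 Cor. 5.4] -/
theorem exists_prod_sqrt_chi_two_dvd_derivedPoint_iff (W : WeierstrassCurve ℚ) [W.IsElliptic]
    [W.IsGloballyMinimal] [NeZero (W.conductorNorm ℤ)] (hCM : W.HasCM) (hin : CMInert W 2)
    (hρ : W.HasSurjectiveModNGaloisRep (2 : ℤ)) (hK : IsImaginaryQuadratic K)
    (hodd : Odd (NumberField.discr K)) (h3 : NumberField.discr K ≠ -3)
    (hH : SatisfiesHeegnerHypothesis (W.conductorNorm ℤ) K)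
    {Dt : ModularParametrizationData W (W.conductorNorm ℤ)} {β : ℤ} {ι : K →+* ℂ} {n : ℕ} (hn : Squarefree n)
    (hKol : ∀ ℓ ∈ n.primeFactors, Zhang2014.IsKolyvaginPrime (W.conductorNorm ℤ) W K 2 ℓ ∧ CMInert W ℓ)
    (d : KolyvaginHeegnerData Dt β ι n) :
    ∃ (Θ : ringClassField K ι n) (χ : (ringClassField K ι n ≃ₐ[ℚ] ringClassField K ι n) → ℤ),
      Θ ^ 2 = algebraMap ℚ (ringClassField K ι n) (∏ ℓ ∈ n.primeFactors, ((-1 : ℚ) ^ (ℓ / 2) * ℓ)) ∧ Θ ≠ 0 ∧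
      (∀ ℓ ∈ n.primeFactors, d.σ ℓ Θ = -Θ) ∧
      (∀ g, g Θ = Θ → χ g = 1) ∧ (∀ g, g Θ ≠ Θ → χ g = -1) ∧ (∀ g h, χ (g * h) = χ g * χ h) ∧
      ((∃ Q : (W.baseChange (ringClassField K ι n)).toAffine.Point, (2 : ℤ) • Q = d.derivedPoint) ↔
        ∃ R : (W.baseChange (ringClassField K ι n)).toAffine.Point,
          (2 : ℤ) • R =
            ∑ s ∈ d.S, χ s • pointGalHom W (ringClassField K ι n) s (n.primeFactorsList.foldr
              (fun ℓ x ↦ ∑ k ∈ range ((ℓ + 1) / 2), pointGalHom W (ringClassField K ι n) ((d.σ ℓ ^ 2) ^ k) x) d.y) ∧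
          ∀ (x y : ringClassField K ι n) (h : (W.baseChange (ringClassField K ι n)).toAffine.Nonsingular x y),
            R = .some x y h →
              ∃ k₁ k₂ : K, ι k₁ = x ∧
                ι k₂ = (((2 * y + (W.baseChange (ringClassField K ι n)).toAffine.a₁ * x +
                  (W.baseChange (ringClassField K ι n)).toAffine.a₃) / Θ : ringClassField K ι n) : ℂ) ∧
                ((∏ ℓ ∈ n.primeFactors, ((-1 : ℚ) ^ (ℓ / 2) * ℓ) : ℚ) : K) * k₂ ^ 2 =
                  4 * k₁ ^ 3 + (W.b₂ : K) * k₁ ^ 2 + 2 * (W.b₄ : K) * k₁ + (W.b₆ : K)) := by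
  obtain ⟨Θ, hΘ2, hΘ, hσΘ⟩ := exists_prod_sqrt_of_isKolyvaginPrime hK W hn (fun ℓ hℓ ↦ (hKol ℓ hℓ).1) d
  have hχp : ∀ g : ringClassField K ι n ≃ₐ[ℚ] ringClassField K ι n,
      g Θ = Θ → (if g Θ = Θ then (1 : ℤ) else -1) = 1 := fun g hg ↦ if_pos hg
  have hχn : ∀ g : ringClassField K ι n ≃ₐ[ℚ] ringClassField K ι n,
      g Θ ≠ Θ → (if g Θ = Θ then (1 : ℤ) else -1) = -1 := fun g hg ↦ if_neg hg
  exact ⟨Θ, fun g ↦ if g Θ = Θ then 1 else -1, hΘ2, hΘ, hσΘ, hχp, hχn, fun g h ↦ chiTheta_mul hΘ hΘ2 _ hχp hχn g h,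
    two_dvd_derivedPoint_iff_exists_rational_twistCoords_allLevels W hCM hin hρ hK hodd h3 hH hn hKol d hΘ hΘ2 hσΘ _
      hχp hχn⟩

end Summit.BirchSwinnertonDyer.BirchSwinnertonDyer.Theorems.CMKolyvaginConjecturePositiveDepth

end
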